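import Literature.Analysis.FluidPDE.NSEnergyClassSlice
import Literature.Analysis.FluidPDE.DuchonRobertLocalBalance
import HarnessLib

/-!
# Weak Navier–Stokes solutions in the energy class on `T^d`: the energy identity at
  truncation level `N` and the linear terms in the limit

Analysis/FluidPDE support file (theorem-only), continuation of
`Literature/Analysis/FluidPDE/NSEnergyClassSlice`: the Galerkin/Fourier-truncation form of the
Lions–Shinbrot argument (`DuchonRobertLionsEnergyEquality`) for a forced weak Navier–Stokes
solution in the energy class (unbundled hypotheses `hw`, `hE`, `hL2`, `hH1`, `hwc` — every
clause of `Torus.IsLerayHopfOn` but the energy inequalities and the strong initial trace), with a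
jointly measurable force `f ∈ L¹(0,T; L²)`:

* `integrableOn_flux_fourierTruncate_L1L2`, `integral_inner_fourierTruncate_self_eq` — the exact
  identity `‖P_M u(t)‖² = ‖P_M u₀‖² + 2∫_{(0,t]} Φ[u; P_M u(s)](s) ds` for every `t ∈ (0, T]`
  (Serrin 1963, §4; the diagonal of the cross identity along the Stokes frame `g_{kjc}` with the
  product formula for primitives);
* `tendsto_setIntegral_toReal_eGradNormSq_fourierTruncate` — `∫₀ᵗ‖∇P_N u‖₂² → ∫₀ᵗ‖∇u‖₂²`
  (monotone convergence);
* `tendsto_setIntegral_work_fourierTruncate` — `∫₀ᵗ∫⟪f, P_N u⟫ → ∫₀ᵗ∫⟪f, u⟫` (dominated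
  convergence).

Proofs are verbatim those of the Leray–Hopf-keyed twins (`Torus.IsLerayHopfOn.*` in
`DuchonRobertLionsEnergyEquality`), which never use the energy inequalities. The nonlinear term
and the energy equality itself are in `Literature/Analysis/FluidPDE/NSEnergyEquality2D`.

## References

* J. Serrin, *The initial value problem for the Navier–Stokes equations*, in: Nonlinear Problems
  (Madison 1962), 1963, §4. [Serrin1963]
* M. Shinbrot, *The energy equation for the Navier–Stokes system*, SIAM J. Math. Anal. 5 (1974),
  948–954. [Shinbrot1974]
* R. Temam, *Navier–Stokes Equations*, 3rd ed., North-Holland 1984, Ch. III §1, Thm. 3.2.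
-/

noncomputable section

open MeasureTheory TopologicalSpace Set Function Filter Topology UnitAddTorus
open scoped InnerProductSpace RealInnerProductSpace ENNReal NNReal ContDiff

namespace Literature.Analysis.FluidPDE

namespace Torus

namespace WeakNSEnergyClass

variable {d : Type*} [Fintype d] [DecidableEq d]

variable {T ν : ℝ} {f u : ℝ → UnitAddTorus d → EuclideanSpace ℝ d}
  {u₀ : UnitAddTorus d → EuclideanSpace ℝ d}

/-! ### The energy identity at truncation level `M` -/

/-- **The flux against the truncations `P_M u(s)` is integrable in time** (`L¹(0,T;L²)` force):
`s ↦ ∫(⟪u,(u·∇)P_M u⟫ + ν⟪u,ΔP_M u⟫ + ⟪f,P_M u⟫)(s)` is integrable on `(0, T)` (along the frame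
it is `∑ᵢ ⟪u(s), gᵢ⟫ · (flux of u against gᵢ)`, bounded coefficients times integrable fluxes;
energy-class twin of `Torus.IsLerayHopfOn.integrableOn_flux_fourierTruncate_L1L2`). [folklore] -/
theorem integrableOn_flux_fourierTruncate_L1L2 (hw : IsWeakNSSolutionForcedOn T ν f u₀ u)
    (hE : ∃ C : ℝ≥0, ∀ᵐ t ∂(volume.restrict (Ioo 0 T)), ∫⁻ x, ‖u t x‖ₑ ^ 2 ≤ C)
    (hL2 : ∀ t ∈ Icc 0 T, MemLp (u t) 2 volume)
    (hwc : ∀ w : UnitAddTorus d → EuclideanSpace ℝ d, MemLp w 2 volume →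
      ContinuousOn (fun t => ∫ x, ⟪u t x, w x⟫) (Ioc 0 T) ∧
        Tendsto (fun t => ∫ x, ⟪u t x, w x⟫) (𝓝[>] 0) (𝓝 (∫ x, ⟪u₀ x, w x⟫)))
    (hfm : AEStronglyMeasurable (FunctionSpaces.Torus.stLift f) (volume.restrict (Ioo 0 T ×ˢ univ)))
    (hf : MemLqLp 1 2 f (Ioo 0 T)) (M : ℕ) :
    IntegrableOn (fun s => ∫ x, (⟪u s x, FunctionSpaces.Torus.convect (u s) (FunctionSpaces.Torus.fourierTruncate M (u s)) x⟫ +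
        ν * ⟪u s x, FunctionSpaces.Torus.laplacian (FunctionSpaces.Torus.fourierTruncate M (u s)) x⟫ +
        ⟪f s x, FunctionSpaces.Torus.fourierTruncate M (u s) x⟫)) (Ioo 0 T) := by
  classical
  set I : Finset ((d → ℤ) × d × Bool) := FunctionSpaces.Torus.freqBall M ×ˢ ((Finset.univ : Finset d) ×ˢ (Finset.univ : Finset Bool))
    with hI
  set a : (d → ℤ) × d × Bool → UnitAddTorus d → EuclideanSpace ℝ d := fun i => frameField i.1 i.2.1 i.2.2 with ha
  have ha_smooth : ∀ i, FunctionSpaces.Torus.IsSmooth (a i) := fun i => isSmooth_frameField _ _ _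
  have ha_cont : ∀ i, Continuous (a i) := fun i => continuous_frameField _ _ _
  -- the frame expansion, for a.e. `s`
  have hIdent : ∀ᵐ s ∂(volume.restrict (Ioo 0 T)),
      ∑ i ∈ I, (∫ x, ⟪u s x, a i x⟫) * ∫ x, (⟪u s x, FunctionSpaces.Torus.convect (u s) (a i) x⟫ +
          ν * ⟪u s x, FunctionSpaces.Torus.laplacian (a i) x⟫ + ⟪f s x, a i x⟫) =
        ∫ x, (⟪u s x, FunctionSpaces.Torus.convect (u s) (FunctionSpaces.Torus.fourierTruncate M (u s)) x⟫ +
          ν * ⟪u s x, FunctionSpaces.Torus.laplacian (FunctionSpaces.Torus.fourierTruncate M (u s)) x⟫ +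
          ⟪f s x, FunctionSpaces.Torus.fourierTruncate M (u s) x⟫) := by
    filter_upwards [ae_integrable_force_slice' hf, ae_restrict_mem measurableSet_Ioo] with s hs hsI
    have hsT : s ∈ Ioc 0 T := Ioo_subset_Ioc_self hsI
    have hus : MemLp (u s) 2 volume := hL2 s ⟨hsT.1.le, hsT.2⟩
    rw [sum_mul_flux_eq I (fun i => ∫ x, ⟪u s x, a i x⟫) ha_smooth ν hus hs,
      fourierTruncate_eq_sum_integral_inner_smul_frameField hus (isWeaklyDivFree_of_mem_Ioc hw hwc hsT) M]
  -- integrability of the expansion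
  have hsum : IntegrableOn (fun s => ∑ i ∈ I, (∫ x, ⟪u s x, a i x⟫) *
      ∫ x, (⟪u s x, FunctionSpaces.Torus.convect (u s) (a i) x⟫ + ν * ⟪u s x, FunctionSpaces.Torus.laplacian (a i) x⟫ +
        ⟪f s x, a i x⟫)) (Ioo 0 T) := by
    refine integrable_finsetSum I fun i _ => ?_
    obtain ⟨C, hC⟩ := exists_ae_abs_integral_inner_le hE hL2 (ha_cont i)
    exact (integrableOn_flux_L1L2 hw hE hL2 hfm hf (ha_smooth i)).bdd_mul
      (aestronglyMeasurable_integral_inner hw (ha_cont i))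
      (hC.mono fun s hs => by rwa [Real.norm_eq_abs])
  exact hsum.congr hIdent

/-- **The energy identity of an energy-class weak solution at truncation level `M`.** Let `u` be
a weak solution on `T^d × [0, T)`, `T > 0`, in `L^∞(0,T;L²)` with `L²` slices, weakly
`L²`-continuous on `(0, T]` with weak limit `u₀` at `0⁺`, with viscosity `ν`, a jointly measurable
force `f ∈ L¹(0,T; L²)` and datum `u₀ ∈ L²`. Then for every truncation level `M` and every
`t ∈ (0, T]`,
`‖P_M u(t)‖²_{L²} = ‖P_M u₀‖²_{L²} + 2 ∫_{(0,t]} Φ[u; P_M u(s)](s) ds`,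
`Φ[u; Ψ](s) = ∫(⟪u(s),(u(s)·∇)Ψ⟫ + ν⟪u(s),ΔΨ⟫ + ⟪f(s),Ψ⟫)` the flux of the time-sliced weak
formulation, the integrand being integrable on `(0,t]`: the Galerkin-level form of "testing the
equation with `u` itself" (Serrin 1963, §4; Shinbrot 1974; the diagonal `U = u` of the cross
identity `Torus.IsLerayHopfOn.integral_inner_fourierTruncate_eq_add_setIntegral`, same proof along
the frame `g_{kjc}` with the product formula for primitives, here with an `L¹(0,T;L²)` force; energy-class twin of
`Torus.IsLerayHopfOn.integral_inner_fourierTruncate_self_eq`). [cite: Serrin1963, §4 (proof of Thm. 6)] -/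
theorem integral_inner_fourierTruncate_self_eq (hw : IsWeakNSSolutionForcedOn T ν f u₀ u)
    (hE : ∃ C : ℝ≥0, ∀ᵐ t ∂(volume.restrict (Ioo 0 T)), ∫⁻ x, ‖u t x‖ₑ ^ 2 ≤ C)
    (hL2 : ∀ t ∈ Icc 0 T, MemLp (u t) 2 volume)
    (hwc : ∀ w : UnitAddTorus d → EuclideanSpace ℝ d, MemLp w 2 volume →
      ContinuousOn (fun t => ∫ x, ⟪u t x, w x⟫) (Ioc 0 T) ∧
        Tendsto (fun t => ∫ x, ⟪u t x, w x⟫) (𝓝[>] 0) (𝓝 (∫ x, ⟪u₀ x, w x⟫)))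
    (hT : 0 < T)
    (hfm : AEStronglyMeasurable (FunctionSpaces.Torus.stLift f) (volume.restrict (Ioo 0 T ×ˢ univ)))
    (hf : MemLqLp 1 2 f (Ioo 0 T)) (hu₀ : MemLp u₀ 2 volume) (M : ℕ) {t : ℝ} (ht : t ∈ Ioc 0 T) :
    IntegrableOn (fun s =>
        ∫ x, (⟪u s x, FunctionSpaces.Torus.convect (u s) (FunctionSpaces.Torus.fourierTruncate M (u s)) x⟫ +
          ν * ⟪u s x, FunctionSpaces.Torus.laplacian (FunctionSpaces.Torus.fourierTruncate M (u s)) x⟫ +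
          ⟪f s x, FunctionSpaces.Torus.fourierTruncate M (u s) x⟫)) (Ioc 0 t) ∧
      ∫ x, ⟪FunctionSpaces.Torus.fourierTruncate M (u t) x, FunctionSpaces.Torus.fourierTruncate M (u t) x⟫ =
        (∫ x, ⟪FunctionSpaces.Torus.fourierTruncate M u₀ x, FunctionSpaces.Torus.fourierTruncate M u₀ x⟫) +
          2 * ∫ s in Ioc 0 t,
            ∫ x, (⟪u s x, FunctionSpaces.Torus.convect (u s) (FunctionSpaces.Torus.fourierTruncate M (u s)) x⟫ +
              ν * ⟪u s x, FunctionSpaces.Torus.laplacian (FunctionSpaces.Torus.fourierTruncate M (u s)) x⟫ +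
              ⟪f s x, FunctionSpaces.Torus.fourierTruncate M (u s) x⟫) := by
  classical
  -- ### the frame
  set I : Finset ((d → ℤ) × d × Bool) := FunctionSpaces.Torus.freqBall M ×ˢ ((Finset.univ : Finset d) ×ˢ (Finset.univ : Finset Bool))
    with hI
  set a : (d → ℤ) × d × Bool → UnitAddTorus d → EuclideanSpace ℝ d := fun i => frameField i.1 i.2.1 i.2.2 with ha
  have ha_smooth : ∀ i, FunctionSpaces.Torus.IsSmooth (a i) := fun i => isSmooth_frameField _ _ _
  have ha_div : ∀ i, FunctionSpaces.Torus.IsDivFree (a i) := fun i => isDivFree_frameField' _ _ _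
  -- ### divergence-free slices and data
  have hdivu : ∀ s ∈ Ioc 0 T, FunctionSpaces.Torus.IsWeaklyDivFree (u s) := fun s hs => isWeaklyDivFree_of_mem_Ioc hw hwc hs
  have hdivu₀ : FunctionSpaces.Torus.IsWeaklyDivFree u₀ := isWeaklyDivFree_datum hw hwc hT
  -- ### the coefficient functions, their fluxes and representations
  set A : (d → ℤ) × d × Bool → ℝ → ℝ := fun i s => ∫ x, ⟪u s x, a i x⟫ with hA
  set φ : (d → ℤ) × d × Bool → ℝ → ℝ := fun i s =>
    ∫ x, (⟪u s x, FunctionSpaces.Torus.convect (u s) (a i) x⟫ + ν * ⟪u s x, FunctionSpaces.Torus.laplacian (a i) x⟫ + ⟪f s x, a i x⟫)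
    with hφ
  have hφint : ∀ i, IntegrableOn (φ i) (Ioo 0 T) := fun i => integrableOn_flux_L1L2 hw hE hL2 hfm hf (ha_smooth i)
  have hArep : ∀ i, ∀ s ∈ Ioc 0 T, A i s = (∫ x, ⟪u₀ x, a i x⟫) + ∫ r in Ioc 0 s, φ i r :=
    fun i s hs => integral_inner_eq_add_setIntegral_L1L2 hw hE hL2 hwc hT hfm hf (ha_smooth i) (ha_div i) hs
  -- ### the product formula, mode by mode
  have hprod := fun i => FunctionSpaces.mul_eq_add_setIntegral_of_eq_add_setIntegral (hφint i) (hφint i)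
    (hArep i) (hArep i) ht
  -- ### sum over the frame
  have hLHS : ∫ x, ⟪FunctionSpaces.Torus.fourierTruncate M (u t) x, FunctionSpaces.Torus.fourierTruncate M (u t) x⟫ =
      ∑ i ∈ I, A i t * A i t :=
    integral_inner_fourierTruncate_fourierTruncate_eq_sum (hL2 t ⟨ht.1.le, ht.2⟩)
      (hL2 t ⟨ht.1.le, ht.2⟩) (hdivu t ht) M
  have h0 : ∫ x, ⟪FunctionSpaces.Torus.fourierTruncate M u₀ x, FunctionSpaces.Torus.fourierTruncate M u₀ x⟫ =
      ∑ i ∈ I, (∫ x, ⟪u₀ x, a i x⟫) * ∫ x, ⟪u₀ x, a i x⟫ :=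
    integral_inner_fourierTruncate_fourierTruncate_eq_sum hu₀ hu₀ hdivu₀ M
  have hsumInt : IntegrableOn (fun s => ∑ i ∈ I, (φ i s * A i s + A i s * φ i s)) (Ioc 0 t) :=
    integrable_finsetSum I fun i _ => (hprod i).1
  have hsumEq : ∑ i ∈ I, A i t * A i t = ∑ i ∈ I, (∫ x, ⟪u₀ x, a i x⟫) * (∫ x, ⟪u₀ x, a i x⟫) +
      ∫ s in Ioc 0 t, ∑ i ∈ I, (φ i s * A i s + A i s * φ i s) := by
    rw [integral_finsetSum I fun i _ => (hprod i).1, ← Finset.sum_add_distrib]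
    exact Finset.sum_congr rfl fun i _ => (hprod i).2
  -- ### identification of the integrand for a.e. `s ∈ (0, t]`
  have hsub : Ioc 0 t ⊆ Ioc 0 T := Ioc_subset_Ioc_right ht.2
  set Φ : ℝ → ℝ := fun s =>
    ∫ x, (⟪u s x, FunctionSpaces.Torus.convect (u s) (FunctionSpaces.Torus.fourierTruncate M (u s)) x⟫ +
      ν * ⟪u s x, FunctionSpaces.Torus.laplacian (FunctionSpaces.Torus.fourierTruncate M (u s)) x⟫ +
      ⟪f s x, FunctionSpaces.Torus.fourierTruncate M (u s) x⟫) with hΦdef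
  have hIdent : ∀ᵐ s ∂(volume.restrict (Ioc 0 t)), ∑ i ∈ I, (φ i s * A i s + A i s * φ i s) = Φ s + Φ s := by
    have h1 : ∀ᵐ s ∂(volume.restrict (Ioc 0 T)), Integrable (f s) volume := by
      rw [← Measure.restrict_congr_set Ioo_ae_eq_Ioc]
      exact ae_integrable_force_slice' hf
    have h2 : ∀ᵐ s ∂(volume.restrict (Ioc 0 t)), Integrable (f s) volume :=
      ae_restrict_of_ae_restrict_of_subset hsub h1
    filter_upwards [h2, ae_restrict_mem measurableSet_Ioc] with s hs hsI
    have hsT : s ∈ Ioc 0 T := hsub hsI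
    have hus : MemLp (u s) 2 volume := hL2 s ⟨hsT.1.le, hsT.2⟩
    have hexp := fourierTruncate_eq_sum_integral_inner_smul_frameField hus (hdivu s hsT) M
    simp only [hΦdef]
    rw [Finset.sum_add_distrib]
    congr 1
    · calc ∑ i ∈ I, φ i s * A i s = ∑ i ∈ I, A i s * φ i s := Finset.sum_congr rfl fun i _ => mul_comm _ _
        _ = _ := sum_mul_flux_eq I (fun i => A i s) ha_smooth ν hus hs
        _ = _ := by rw [hexp]
    · calc ∑ i ∈ I, A i s * φ i s = _ := sum_mul_flux_eq I (fun i => A i s) ha_smooth ν hus hs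
        _ = _ := by rw [hexp]
  have hΦ2 : IntegrableOn (fun s => Φ s + Φ s) (Ioc 0 t) := hsumInt.congr hIdent
  have hΦ : IntegrableOn Φ (Ioc 0 t) :=
    (hΦ2.const_mul (2⁻¹ : ℝ)).congr (ae_of_all _ fun s => by ring)
  refine ⟨hΦ, ?_⟩
  rw [hLHS, hsumEq, h0, integral_congr_ae hIdent, integral_add hΦ hΦ, two_mul]

/-! ### The truncated dissipation and the work in the limit `N → ∞` -/

/-- Time-measurability of the truncated dissipation `s ↦ ‖∇P_N u(s)‖₂²` of a weak solution with
`L²` slices (its Fourier coefficients are those of `u(s)` on the ball and `0` outside). [folklore] -/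
theorem aemeasurable_eGradNormSq_fourierTruncate (hw : IsWeakNSSolutionForcedOn T ν f u₀ u)
    (hL2 : ∀ t ∈ Icc 0 T, MemLp (u t) 2 volume) (N : ℕ) :
    AEMeasurable (fun s => FunctionSpaces.Torus.eGradNormSq (FunctionSpaces.Torus.fourierTruncate N (u s)))
      (volume.restrict (Ioo 0 T)) := by
  classical
  refine Torus.aemeasurable_eGradNormSq_of_coeff fun k => ?_
  by_cases hk : k ∈ FunctionSpaces.Torus.freqBall N
  · refine (aestronglyMeasurable_mFourierCoeff_complexify hw k).congr ?_
    filter_upwards [ae_restrict_mem measurableSet_Ioo] with s hs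
    rw [FunctionSpaces.Torus.mFourierCoeff_fourierTruncate ((hL2 s (Ioo_subset_Icc_self hs)).integrable one_le_two),
      if_pos hk]
  · refine (aestronglyMeasurable_const (b := (0 : EuclideanSpace ℂ d))).congr ?_
    filter_upwards [ae_restrict_mem measurableSet_Ioo] with s hs
    rw [FunctionSpaces.Torus.mFourierCoeff_fourierTruncate ((hL2 s (Ioo_subset_Icc_self hs)).integrable one_le_two),
      if_neg hk]

/-- **The truncated dissipation converges**: for every `t ∈ (0, T]`,
`∫_{(0,t]} ‖∇P_N u(s)‖₂² ds → ∫₀ᵗ ‖∇u‖₂²` (monotone convergence along the exhausting balls,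
the limit being finite in `L²(0,T;H¹)`). [folklore] -/
theorem tendsto_setIntegral_toReal_eGradNormSq_fourierTruncate (hw : IsWeakNSSolutionForcedOn T ν f u₀ u)
    (hL2 : ∀ t ∈ Icc 0 T, MemLp (u t) 2 volume)
    (hH1 : FunctionSpaces.Torus.MemL2Sobolev 0 T 1 (fun t => FunctionSpaces.EuclideanSpace.complexify ∘ u t))
    {t : ℝ} (ht : t ∈ Ioc 0 T) :
    (∀ N, IntegrableOn (fun s => (FunctionSpaces.Torus.eGradNormSq (FunctionSpaces.Torus.fourierTruncate N (u s))).toReal)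
      (Ioc 0 t)) ∧
    Tendsto (fun N => ∫ s in Ioc 0 t, (FunctionSpaces.Torus.eGradNormSq (FunctionSpaces.Torus.fourierTruncate N (u s))).toReal)
      atTop (𝓝 ((∫⁻ s in Ioo 0 t, FunctionSpaces.Torus.eGradNormSq (u s)).toReal)) := by
  set μt : Measure ℝ := volume.restrict (Ioo 0 t) with hμt
  have hsub : Ioo 0 t ⊆ Ioo 0 T := Ioo_subset_Ioo le_rfl ht.2
  have hle : μt ≤ volume.restrict (Ioo 0 T) := Measure.restrict_mono hsub le_rfl
  set G : ℕ → ℝ → ℝ≥0∞ := fun N s =>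
    FunctionSpaces.Torus.eGradNormSq (FunctionSpaces.Torus.fourierTruncate N (u s)) with hG
  set g : ℝ → ℝ≥0∞ := fun s => FunctionSpaces.Torus.eGradNormSq (u s) with hg
  have hG_m : ∀ N, AEMeasurable (G N) (volume.restrict (Ioo 0 T)) := fun N =>
    aemeasurable_eGradNormSq_fourierTruncate hw hL2 N
  have hfin : ∫⁻ s in Ioo 0 t, g s ≠ ⊤ :=
    ((lintegral_mono' hle le_rfl).trans_lt (lintegral_eGradNormSq_lt_top_of_memL2Sobolev hH1)).ne
  -- ### integrability of the truncated dissipation on `(0, t]`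
  have hGle : ∀ N, ∀ s ∈ Ioo 0 t, G N s ≤ g s := fun N s hs =>
    Torus.eGradNormSq_fourierTruncate_le ((hL2 s (Ioo_subset_Icc_self (hsub hs))).integrable one_le_two) N
  have hInt : ∀ N, IntegrableOn (fun s => (G N s).toReal) (Ioc 0 t) := by
    intro N
    rw [IntegrableOn, ← Measure.restrict_congr_set Ioo_ae_eq_Ioc]
    refine integrable_toReal_of_lintegral_ne_top ((hG_m N).mono_measure hle) (ne_top_of_le_ne_top hfin ?_)
    exact setLIntegral_mono' measurableSet_Ioo fun s hs => hGle N s hs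
  refine ⟨hInt, ?_⟩
  -- monotone convergence in `ℝ≥0∞`
  have hL : Tendsto (fun N => ∫⁻ s in Ioo 0 t, G N s) atTop (𝓝 (∫⁻ s in Ioo 0 t, g s)) := by
    have hcoef : ∀ s ∈ Ioo 0 t, ∀ N, G N s = ENNReal.ofReal (4 * Real.pi ^ 2) *
        ∑ k ∈ FunctionSpaces.Torus.freqBall N, ENNReal.ofReal (FunctionSpaces.Torus.freqNormSq k) *
          ‖mFourierCoeff (FunctionSpaces.EuclideanSpace.complexify ∘ u s) k‖ₑ ^ 2 := by
      intro s hs N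
      exact Torus.eGradNormSq_fourierTruncate_eq_sum ((hL2 s (Ioo_subset_Icc_self (hsub hs))).integrable one_le_two) N
    refine lintegral_tendsto_of_tendsto_of_monotone (fun N => (hG_m N).mono_measure hle) ?_ ?_
    · filter_upwards [ae_restrict_mem measurableSet_Ioo] with s hs
      intro N N' hNN'
      show G N s ≤ G N' s
      rw [hcoef s hs N, hcoef s hs N']
      exact mul_le_mul' le_rfl (Finset.sum_le_sum_of_subset (FunctionSpaces.Torus.freqBall_mono hNN'))
    · filter_upwards [ae_restrict_mem measurableSet_Ioo] with s hs
      have hsum := (ENNReal.summable (f := fun k : d → ℤ =>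
        ENNReal.ofReal (FunctionSpaces.Torus.freqNormSq k) *
          ‖mFourierCoeff (FunctionSpaces.EuclideanSpace.complexify ∘ u s) k‖ₑ ^ 2)).hasSum
      have h := ENNReal.Tendsto.const_mul (hsum.comp FunctionSpaces.Torus.tendsto_freqBall_atTop)
        (Or.inr (ENNReal.ofReal_ne_top (r := 4 * Real.pi ^ 2)))
      rw [← FunctionSpaces.Torus.eGradNormSq_eq_tsum] at h
      exact h.congr fun N => (hcoef s hs N).symm
  -- the limit is finite, so `toReal` is continuous there
  have hL' := (ENNReal.tendsto_toReal hfin).comp hL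
  -- the truncated dissipation as a Bochner integral over `(0, t]`
  refine hL'.congr fun N => ?_
  have hfinN : ∀ᵐ s ∂μt, G N s < ⊤ := ae_of_all _ fun s =>
    FunctionSpaces.Torus.eGradNormSq_lt_top (FunctionSpaces.Torus.isSmooth_fourierTruncate N _)
  rw [Function.comp_apply, ← integral_toReal ((hG_m N).mono_measure hle) hfinN, hμt,
    setIntegral_congr_set Ioo_ae_eq_Ioc]

/-- **The work of the force against the truncations converges**: for an energy-class weak
solution with a jointly measurable force `f ∈ L¹(0,T; L²)` and every `t ∈ (0, T]`,
`∫_{(0,t]} ∫⟪f, P_N u⟫ ds → ∫_{(0,t]} ∫⟪f, u⟫ ds` — dominated convergence in time: slice-wise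
`∫⟪f(s), P_N u(s)⟫ → ∫⟪f(s), u(s)⟫` (Parseval), dominated by `‖f(s)‖₂ ‖u(s)‖₂ ≤ C^{1/2}‖f(s)‖₂`. [folklore] -/
theorem tendsto_setIntegral_work_fourierTruncate (hw : IsWeakNSSolutionForcedOn T ν f u₀ u)
    (hE : ∃ C : ℝ≥0, ∀ᵐ t ∂(volume.restrict (Ioo 0 T)), ∫⁻ x, ‖u t x‖ₑ ^ 2 ≤ C)
    (hL2 : ∀ t ∈ Icc 0 T, MemLp (u t) 2 volume)
    (hfm : AEStronglyMeasurable (FunctionSpaces.Torus.stLift f) (volume.restrict (Ioo 0 T ×ˢ univ)))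
    (hf : MemLqLp 1 2 f (Ioo 0 T)) {t : ℝ} (ht : t ∈ Ioc 0 T) :
    (∀ N, IntegrableOn (fun s => ∫ x, ⟪f s x, FunctionSpaces.Torus.fourierTruncate N (u s) x⟫) (Ioc 0 t)) ∧
    Tendsto (fun N => ∫ s in Ioc 0 t, ∫ x, ⟪f s x, FunctionSpaces.Torus.fourierTruncate N (u s) x⟫)
      atTop (𝓝 (∫ s in Ioc 0 t, ∫ x, ⟪f s x, u s x⟫)) := by
  set μT : Measure ℝ := volume.restrict (Ioo 0 T) with hμT
  set μt : Measure ℝ := volume.restrict (Ioo 0 t) with hμt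
  have hsub : Ioo 0 t ⊆ Ioo 0 T := Ioo_subset_Ioo le_rfl ht.2
  have hle : μt ≤ μT := Measure.restrict_mono hsub le_rfl
  obtain ⟨hfs, hNint⟩ := force_L1L2_bookkeeping hfm hf
  obtain ⟨C₀, hC₀⟩ := hE
  -- ### measurability
  have hu' := aestronglyMeasurable_uncurry hw
  have hf' : AEStronglyMeasurable (uncurry f) (μT.prod volume) := by
    have h := FunctionSpaces.Torus.aestronglyMeasurable_uncurry_of_stLift_restrict hfm
    rwa [Measure.volume_eq_prod, ← Measure.prod_restrict, Measure.restrict_univ] at h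
  have hprod : μt.prod (volume : Measure (UnitAddTorus d)) ≤ μT.prod volume := Measure.prod_mono hle le_rfl
  have hu't : AEStronglyMeasurable (uncurry u) (μt.prod volume) := hu'.mono_measure hprod
  have hf't : AEStronglyMeasurable (uncurry f) (μt.prod volume) := hf'.mono_measure hprod
  set F : ℕ → ℝ → ℝ := fun N s => ∫ x, ⟪f s x, FunctionSpaces.Torus.fourierTruncate N (u s) x⟫ with hF
  have hFm : ∀ N, AEStronglyMeasurable (F N) μt := fun N =>
    aestronglyMeasurable_integral_inner_fourierTruncate hf't hu't N
  -- ### the dominating function `C₀^{1/2} ‖f(s)‖₂`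
  set K : ℝ≥0∞ := (C₀ : ℝ≥0∞) ^ (1 / 2 : ℝ) with hK
  have hKtop : K ≠ ⊤ := ENNReal.rpow_ne_top_of_nonneg (by norm_num) ENNReal.coe_ne_top
  have hbound_int : Integrable (fun s => K.toReal * (eLpNorm (f s) 2 volume).toReal) μt :=
    (hNint.mono_measure hle).const_mul _
  have h_bound : ∀ N, ∀ᵐ s ∂μt, ‖F N s‖ ≤ K.toReal * (eLpNorm (f s) 2 volume).toReal := by
    intro N
    filter_upwards [hC₀.filter_mono (ae_mono hle), hfs.filter_mono (ae_mono hle),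
      ae_restrict_mem measurableSet_Ioo] with s hC hfs2 hs
    have hmem : MemLp (u s) 2 volume := hL2 s (Ioo_subset_Icc_self (hsub hs))
    -- `‖u(s)‖₂ ≤ K`
    have huK : eLpNorm (u s) 2 volume ≤ K := by
      rw [hK, eLpNorm_eq_lintegral_rpow_enorm_toReal two_ne_zero ENNReal.ofNat_ne_top, ENNReal.toReal_ofNat]
      simp only [ENNReal.rpow_two]
      exact ENNReal.rpow_le_rpow hC (by norm_num)
    have h1 := enorm_integral_inner_le_eLpNorm_two_mul hfs2.1
      (FunctionSpaces.Torus.memLp_fourierTruncate N (u s) 2).1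
    have h2 : ‖F N s‖ₑ ≤ eLpNorm (f s) 2 volume * K :=
      h1.trans (mul_le_mul' le_rfl ((eLpNorm_fourierTruncate_le hmem N).trans huK))
    have hfin : eLpNorm (f s) 2 volume * K ≠ ⊤ := ENNReal.mul_ne_top hfs2.eLpNorm_ne_top hKtop
    have h3 := ENNReal.toReal_mono hfin h2
    rw [Real.enorm_eq_ofReal_abs, ENNReal.toReal_ofReal (abs_nonneg _), ← Real.norm_eq_abs,
      ENNReal.toReal_mul] at h3
    linarith [h3]
  -- ### slice convergence for a.e. time
  have h_lim : ∀ᵐ s ∂μt, Tendsto (fun N => F N s) atTop (𝓝 (∫ x, ⟪f s x, u s x⟫)) := by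
    filter_upwards [hfs.filter_mono (ae_mono hle), ae_restrict_mem measurableSet_Ioo] with s hfs2 hs
    have hmem : MemLp (u s) 2 volume := hL2 s (Ioo_subset_Icc_self (hsub hs))
    exact tendsto_integral_inner_fourierTruncate hfs2 hmem
  -- ### integrability and dominated convergence
  have hInt : ∀ N, IntegrableOn (F N) (Ioc 0 t) := fun N => by
    rw [IntegrableOn, ← Measure.restrict_congr_set Ioo_ae_eq_Ioc]
    exact hbound_int.mono' (hFm N) (h_bound N)
  refine ⟨hInt, ?_⟩
  have hDC := tendsto_integral_of_dominated_convergence (fun s => K.toReal * (eLpNorm (f s) 2 volume).toReal)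
    hFm hbound_int h_bound h_lim
  rw [hμt, setIntegral_congr_set Ioo_ae_eq_Ioc] at hDC
  refine hDC.congr fun N => ?_
  rw [setIntegral_congr_set Ioo_ae_eq_Ioc]

end WeakNSEnergyClass

end Torus

end Literature.Analysis.FluidPDE

end
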